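import Mathlib
import Summits.Ventures.HodgeRepro2.ReflexSignatureComplex
import Summits.Ventures.HodgeRepro2.ReflexComplex
import Summits.Ventures.HodgeRepro2.T6B2Defs
import Summits.Ventures.HodgeRepro2.T6B2Hyp

/-!
# T6B2Reflex — the three B2 displays discharged; Shimura Prop. 28 over `Gal(ℂ/ℚ)`

Glue only (TARGET-T6 §2: «Tier 6 writes the GLUE … not new mathematics»): every fact used is an
ACCEPTED cell theorem imported by name.
* `Hyp.Liu2021_RemC_2_ReflexField` (Liu Rem. C.2, «the reflex field of h_{V,τ′} is τ′(E)», read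
  through Def. C.1 and p. 108 ll. 28–29) is seat p4's
  `ReflexSignatureComplex.reflexFieldOfSig_reducedSig_eq_fieldRange` (TIER4 §B2.4(a)–(c)).
* `Hyp.Shimura1998_Prop28_TraceField` (K* = Q(Σ_i ξ^{φ_i}) is the subfield corresponding to H*,
  read in Aut(ℂ)): seat p1's `mem_fixingSubgroup_complexTraceField_iff` says that
  `T6B2Defs.typeStabilizerAut Φ` IS the fixing subgroup of `complexTraceField Φ` (the last sentence of
  Shimura's proof, chunk p0083 l. 7), and seat p4's `mem_of_forall_algEquiv_fix` gives
  `Fix_ℂ(Aut(ℂ/k)) = k` (TIER4 §B2.4(b)); together `complexTraceField Φ = Fix(H*)`.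
* `Hyp.Shimura1998_Sec8_4_Ex1_Primitive` (abelian + primitive ⇒ K* = F): seat p1's
  `traceField_eq_top_of_isPrimitiveOn` transported to `ℂ` by seat p1's `map_traceField`.
No surjectivity of the restriction `Gal(ℂ/ℚ) → Gal(τ₀(K)/ℚ)` is used anywhere (p4's hand-off
route/T6-B2-HANDOFF-p4.md §4(a) is not needed).
-/

namespace Summit.Ventures.HodgeRepro2.T6.B2Reflex

open Summit.Ventures.HodgeRepro2 T6.B2Defs
open scoped Summit.Ventures.HodgeRepro2.ReflexSignature

/-- TIER4 §B2.4(b) in set form: for an intermediate field `E` of `ℂ/ℚ`, the fixed field in `ℂ` of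
the subgroup of `Gal(ℂ/ℚ)` fixing `E` pointwise is `E` (seat p4's `mem_of_forall_algEquiv_fix`;
`ℂ/ℚ` is not algebraic, so Mathlib's Galois correspondence does not apply directly). -/
theorem fixedField_fixingSubgroup_complex (E : IntermediateField ℚ ℂ) :
    IntermediateField.fixedField E.fixingSubgroup = E := by
  ext x
  rw [IntermediateField.mem_fixedField_iff]
  constructor
  · intro h
    exact ReflexSignatureComplex.mem_of_forall_algEquiv_fix E x
      (fun σ hσ => h σ ((IntermediateField.mem_fixingSubgroup_iff E σ).2 hσ))
  · intro hx σ hσ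
    exact (IntermediateField.mem_fixingSubgroup_iff E σ).1 hσ x hx

/-- The display `Hyp.Liu2021_RemC_2_ReflexField` is discharged: for `sig′ = 1·τ′` the fixed field
in `ℂ` of the stabiliser in `Gal(ℂ/ℚ)` is `τ′(E)` — seat p4's theorem, the CM hypotheses being idle. -/
theorem Liu2021_RemC_2_ReflexField_holds : Hyp.Liu2021_RemC_2_ReflexField := by
  intro K _ _ _ Φ _ τ' _
  exact @ReflexSignatureComplex.reflexFieldOfSig_reducedSig_eq_fieldRange K _ _ (Classical.decEq _)
    τ'.toRatAlgHom

variable {K : Type*} [Field K]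

/-- Shimura's `H*` (in `Aut(ℂ)`) is the subgroup fixing the trace field `K*` pointwise — the last
sentence of the proof of Prop. 28 («H* is the set of all the elements of G leaving invariant every
element of Q(Σ_i ξ^{φ_i} | ξ ∈ F)»), from seat p1's `mem_fixingSubgroup_complexTraceField_iff`. -/
theorem typeStabilizerAut_eq_fixingSubgroup (Φ : Finset (K →+* ℂ)) :
    typeStabilizerAut Φ = (complexTraceField Φ).fixingSubgroup := by
  ext σ
  rw [mem_typeStabilizerAut_iff, mem_fixingSubgroup_complexTraceField_iff]

/-- Shimura 1998 Prop. 28 over `Gal(ℂ/ℚ)` (TIER4 §B2.7(a)): the trace field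
`K* = Q(Σ_{φ∈Φ} φ ξ | ξ ∈ K) ⊂ ℂ` is the fixed field of `H* = {σ ∈ Gal(ℂ/ℚ) : σ ∘ Φ = Φ}` — for every
field `K` and every finite set `Φ` of complex embeddings (no CM hypothesis is needed). -/
theorem complexTraceField_eq_fixedField (Φ : Finset (K →+* ℂ)) :
    complexTraceField Φ = IntermediateField.fixedField (typeStabilizerAut Φ) := by
  rw [typeStabilizerAut_eq_fixingSubgroup, fixedField_fixingSubgroup_complex]

/-- The display `Hyp.Shimura1998_Prop28_TraceField` is discharged. -/
theorem Shimura1998_Prop28_TraceField_holds : Hyp.Shimura1998_Prop28_TraceField := by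
  intro K _ _ _ Φ _
  exact complexTraceField_eq_fixedField Φ

section Galois

variable [NumberField K] [IsGalois ℚ K]

open Classical in
/-- Shimura §8.4 Ex. (1), field clause, over `ℂ`: a primitive type on a Galois number field has
trace (reflex) field `τ₀(K)` — seat p1's `traceField_eq_top_of_isPrimitiveOn` transported to `ℂ`
along `τ₀` by seat p1's `map_traceField`. -/
theorem complexTraceField_eq_fieldRange_of_isPrimitiveOn (τ₀ : K →+* ℂ) (S : Finset (K ≃ₐ[ℚ] K))
    (hS : IsPrimitiveOn (S : Set (K ≃ₐ[ℚ] K))) :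
    complexTraceField (Finset.image (galEmb K τ₀) S) = τ₀.toRatAlgHom.fieldRange := by
  rw [← map_traceField, traceField_eq_top_of_isPrimitiveOn S hS]
  exact (AlgHom.fieldRange_eq_map τ₀.toRatAlgHom).symm

open Classical in
/-- A finite set of embeddings of a Galois number field, pulled back to `Gal(K/ℚ)` along the
bijection `galEmb K τ₀` (σ ↦ τ₀ ∘ σ) and pushed forward again. -/
theorem image_galEmb_map_symm (τ₀ : K →+* ℂ) (Φ : Finset (K →+* ℂ)) :
    Finset.image (galEmb K τ₀) (Φ.map (galEmb K τ₀).symm.toEmbedding) = Φ := by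
  ext φ
  rw [Finset.mem_image]
  constructor
  · rintro ⟨a, ha, rfl⟩
    rw [Finset.mem_map_equiv, Equiv.symm_symm] at ha
    exact ha
  · intro h
    exact ⟨(galEmb K τ₀).symm φ, by rw [Finset.mem_map_equiv, Equiv.symm_symm]; simpa using h,
      Equiv.apply_symm_apply _ _⟩

/-- The pulled-back finset, as a set, is the preimage of `Φ` under `galEmb K τ₀` (seat p1's
`IsPrimitiveOn (galEmb K τ₀ ⁻¹' Φ)` form of Shimura's primitivity criterion). -/
theorem coe_map_symm_galEmb (τ₀ : K →+* ℂ) (Φ : Finset (K →+* ℂ)) :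
    ((Φ.map (galEmb K τ₀).symm.toEmbedding : Finset (K ≃ₐ[ℚ] K)) : Set (K ≃ₐ[ℚ] K)) =
      galEmb K τ₀ ⁻¹' (Φ : Set (K →+* ℂ)) := by
  rw [Finset.coe_map, Equiv.coe_toEmbedding, Equiv.image_eq_preimage_symm, Equiv.symm_symm]

/-- The display `Hyp.Shimura1998_Sec8_4_Ex1_Primitive` is discharged (the abelian hypothesis is
idle: seat p1's theorem holds for every finite Galois group). -/
theorem Shimura1998_Sec8_4_Ex1_Primitive_holds : Hyp.Shimura1998_Sec8_4_Ex1_Primitive := by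
  intro K _ _ _ _ _ τ₀ Φ _ _ hprim
  rw [← image_galEmb_map_symm τ₀ Φ]
  apply complexTraceField_eq_fieldRange_of_isPrimitiveOn
  rw [coe_map_symm_galEmb]
  exact hprim

end Galois

end Summit.Ventures.HodgeRepro2.T6.B2Reflex
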